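import Summits.Ventures.AbcSig.Rows.TemplateC
import Summits.Ventures.AbcSig.Levels.N18

/-!
# Venture AbcSig — ROW: `xⁿ + yⁿ = 3 z²`, `xy` even (level 18 has no newforms)

HONEST FRAMING. A CONDITIONAL theorem of a COMPUTATION cell (`pub-abcsig`); no claim on ABC or any summit. [BS04, Thm. 1.1]
covers `C = 3`; for `xy` even the Frey curve is in case (v) and the level is `2·3² = 18`, where there are no weight-2
newforms ([BS04, Prop. 4.1]). Hypotheses: `BS04Package` (CITED) and `DataComplete 18 []` (the statement "no newforms of
level 18", CITED/COMPUTED). Everything else is the kernel (`Rows/TemplateC.lean`).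
-/

namespace Summit.Ventures.AbcSig

/-- `xⁿ + yⁿ = 3 z²` has no solution in nonzero pairwise coprime integers with `xy` even, for every prime `n ≥ 7`,
conditional on `BS04Package` and on "level 18 has no newforms". -/
theorem row_XnYn3Z2Even (M : NewformModel) (hP : M.BS04Package) (hD18 : M.DataComplete 18 level18Orbits)
    (n : ℕ) (hn : n.Prime) (hmin : 7 ≤ n) (a b c : ℤ) (hpar : 2 ∣ a * b) : ¬ IsPrimitiveSolution 1 1 3 n a b c := by
  have hC : Nat.Prime 3 := by norm_num
  have hnC : ¬ n ∣ 3 := by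
    intro h
    rcases (Nat.dvd_prime hC).mp h with h1 | h1 <;> omega
  exact row_template_even 3 (Nat.prime_iff.mp hC).squarefree (by decide) M hP hD18 n hn hmin hnC
    (level18_sieve n hn hmin (fun o => M.Excludes 18 o (fun S => S.A = 1 ∧ S.B = 1 ∧ S.C = 3 ∧ S.n = n ∧ 2 ∣ S.a * S.b)))
    a b c hpar

end Summit.Ventures.AbcSig
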